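import Summits.CriticalPhenomena.PercolationContinuityZ3.Theses.PercLoopDislocationCovers
import Literature.Probability.Percolation.SusceptibilityGammaOne

/-!
# Line `birth` — registered skeleton for the crux `Z3SubcritLengthExponent` (stmt-CriticalPhenomena-6529)

Crux (FIXED; rank 3 of `route-CriticalPhenomena-PercLoopDislocationCovers`, shared with
`route-CriticalPhenomena-PercDislocationCovers`): there are `ν < 6/5` and `C` such that for every
`p < p_c(ℤ³)` and every `L ≥ C (p_c − p)^{−ν}` the finite-size criterion
`(2L+1)³ · P_p(0 ↔ ∂B(L)) ≤ 1/2` holds (event `siteToBoundary 3 L`) — a POLYNOMIAL bound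
`ξ(p_c − ε) log ξ ≲ ε^{−ν'}`, `ν' < 6/5`, on the subcritical correlation length of bond percolation on
`ℤ³` (numerics `ν ≈ 0.876`; rigorous state of the art `ξ ≤ exp(C ε^{−2})`,
DuminilcopinKozmaTassion2020 Thm 2).

## The cut — Fisher's relation `ν = γ / (2 − η)` made into two named lemmas (Kesten's 1987
## scaling-relation strategy, transplanted from `ℤ²` to the finite-size criterion on `ℤ³`)

Write `M_p(n) := Σ_{x ∈ B(n)} τ_p(0, x)` (two-point mass in the box; `tau`, `box` of the tree) and
`χ(p) = Σ_x τ_p(0, x)` (`Literature.Probability.Percolation.chi 3 p`, summable for `p < p_c` by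
`summable_tau_of_lt_criticalProb`, so `M_p(n) ≤ χ(p)`).

* S1 `stub_chiUpperGammaTwo` — SUSCEPTIBILITY EXPONENT BOUND `γ' = 2`:
  `χ(p) · (p_c − p)² ≤ C` for all `p < p_c(ℤ³)`. Truth (numerics, arXiv:1302.0421: `γ/ν = 2.046`,
  `1/ν = 1.141`) `γ ≈ 1.79`, margin `0.21`; rigorous: only the LOWER bound `χ ≥ c (p_c − p)^{−1}`
  (AizenmanNewman1984; Grimmett1999 Thm 10.29) — no polynomial upper bound on `χ` is known in
  `d = 3` (it would already give `ξ ≲ χ ≲ ε^{−2}` by the Hammersley/Simon–Lieb iteration, i.e. a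
  polynomial correlation length with exponent `2`, far from `6/5`: S1 alone is NOT the crux; nor does
  the crux give S1: `ξ ≲ ε^{−6/5}` bounds `χ ≲ |B(ξ log ξ)|` only by `ε^{−18/5}`).
  Why it might fail: a first proof of any polynomial `χ` bound in `d = 3` may land above `2`
  (mean-field value `1`, truth `1.79`); in a discontinuous world `χ` may still blow up fast.
* S2 `stub_quasicriticalMass` — QUASI-CRITICAL MASS PLATEAU BELOW THE CRITERION SCALE
  (`2 − η' > 5/3`): there are `a > 5/3`, `c > 0` with `M_p(n) ≥ c n^a` for every `p < p_c` and every
  `n ≥ 1` at which the criterion FAILS, `(2n+1)³ P_p(0 ↔ ∂B(n)) > 1/2`. Scaling picture: failure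
  forces `n ≲ 3 ξ(p) log n`, and `M_p(n) ≍ min(n, ξ)^{2−η}` with `2 − η ≈ 2.046 > 5/3` (margin
  `0.38`; the `log` is absorbed by the polynomial margin, binding regime `ξ ≈ 10²–10³`, `c ≈ 0.05·κ`).
  This is the `ℤ³`/one-arm analogue of Kesten's stability theorem "below the finite-size length
  `L(p)` arm probabilities are comparable to critical ones" (Kesten 1987, CMP 109, Thm 1 / (1.23);
  Borgs–Chayes–Kesten–Spencer 2001, CMP 224, `χ(p) ≍ L(p)² π(L(p))` under their scaling
  postulates), with the exponent input `η < 1/3` at `p_c`. Rigorous floor: `Σ_{x ∈ ∂B(n)} τ_{p_c} ≥ c`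
  (`φ_{p_c}(B_n) ≥ 1`, DuminilCopinTassionCMP2016 Thm 1.1 proof) gives only `M_{p_c}(n) ≥ c n`.
  Why it might fail: uniformity in `p` up to the criterion scale `≈ 3 ξ log ξ` (not just `ξ`) is a
  genuine near-critical stability statement with no RSW in `d = 3`; and `η < 1/3` is open.

`Z3SubcritLengthExponent_of` (kernel-checked, no `sorry` of its own): with `ν := 2/a < 6/5` and
`C := (max C₁ 1 / c)^{1/a} + 1`, if the criterion failed at some `L ≥ C ε^{−ν}` (`ε = p_c − p > 0`)
then `c L^a ≤ M_p(L) ≤ χ(p) ≤ max C₁ 1 · ε^{−2}`, whereas `L > (max C₁ 1 / c)^{1/a} ε^{−2/a}` gives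
`c L^a ε² > max C₁ 1` — contradiction. Hypotheses = the two stubs under their registered names;
conclusion = the route decl
`Summit.CriticalPhenomena.PercolationContinuityZ3.Theses.PercLoopDislocationCovers.Z3SubcritLengthExponent`
BY NAME. Neither stub implies the crux or the sub-problem statement cheaply (BC3 probes
`stub → crux`, `stub → PercolationContinuityZ3` by `first | exact? | simpa | aesop` fail, 4/4), and
neither implies the other: S1 bounds `ξ` only with exponent `2`, S2 is a lower bound on connectivity.

Both stubs are stated in TREE VOCABULARY ONLY, fully qualified (`chi`, `tau`, `box`, `criticalProb`,
`bondPercolation`, `siteToBoundary`, `zdGraph`), so each lands verbatim as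
`Theorems/PercLoopDislocationCoversZ3SubcritLengthExponent<Stub>.lean --supports stmt-CriticalPhenomena-6529`.
Disproof used: none relevant (no `Disproof.lean` / Negative lemma exists for this crux at registration).
-/

noncomputable section

open Literature.Probability.Percolation Literature.Probability.LatticeModels

namespace Summit.CriticalPhenomena.PercolationContinuityZ3.Cruxes.Z3SubcritLengthExponent.Birth

/-! ### The two statements, named (proof-side abbreviations; the stubs themselves inline everything) -/

/-- **S1, named.** Susceptibility exponent bound `γ' = 2` on `ℤ³`: `χ(p) (p_c − p)² ≤ C` below `p_c`. -/
def ChiUpperGammaTwo : Prop :=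
  ∃ C : ℝ, ∀ p : unitInterval,
    (p : ℝ) < Literature.Probability.Percolation.criticalProb (Literature.Probability.LatticeModels.zdGraph 3) 0 →
      Literature.Probability.Percolation.chi 3 p *
          (Literature.Probability.Percolation.criticalProb (Literature.Probability.LatticeModels.zdGraph 3) 0 - p) ^ 2 ≤ C

/-- **S2, named.** Quasi-critical mass plateau: at every subcritical `p` and every scale `n ≥ 1` where
the finite-size criterion fails, the two-point mass in `B(n)` is at least `c n^a`, some `a > 5/3`. -/
def QuasicriticalMass : Prop :=
  ∃ a c : ℝ, 5 / 3 < a ∧ 0 < c ∧ ∀ p : unitInterval,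
    (p : ℝ) < Literature.Probability.Percolation.criticalProb (Literature.Probability.LatticeModels.zdGraph 3) 0 →
      ∀ n : ℕ, 1 ≤ n →
        1 / 2 < ((2 * n + 1) ^ 3 : ℝ) *
            (Literature.Probability.Percolation.bondPercolation (Literature.Probability.LatticeModels.zdGraph 3) p).real
              (Literature.Probability.Percolation.siteToBoundary 3 n) →
          c * (n : ℝ) ^ a ≤ ∑ x ∈ Literature.Probability.LatticeModels.box 3 n, Literature.Probability.Percolation.tau 3 p 0 x

/-! ### The stubs (the ONLY `sorry`s of this file) -/

/-- **S1 — susceptibility exponent bound `γ' = 2` (bond percolation on `ℤ³`, subcritical).** There is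
`C` such that `χ(p) · (p_c − p)² ≤ C` for every `p < p_c(ℤ³)`, `χ(p) = Σ_x τ_p(0,x)`
(`Literature.Probability.Percolation.chi`). Truth `γ ≈ 1.79`; known: `γ ≥ 1` only
(AizenmanNewman1984); no polynomial upper bound on `χ` is known in `d = 3`. Size: open problem (L+). -/
theorem stub_chiUpperGammaTwo :
    ∃ C : ℝ, ∀ p : unitInterval,
    (p : ℝ) < Literature.Probability.Percolation.criticalProb (Literature.Probability.LatticeModels.zdGraph 3) 0 →
      Literature.Probability.Percolation.chi 3 p *
          (Literature.Probability.Percolation.criticalProb (Literature.Probability.LatticeModels.zdGraph 3) 0 - p) ^ 2 ≤ C := by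
  sorry

/-- **S2 — quasi-critical mass plateau below the criterion scale (`2 − η' > 5/3`).** There are
`a > 5/3` and `c > 0` such that for every `p < p_c(ℤ³)` and every `n ≥ 1` at which the finite-size
criterion fails, `(2n+1)³ · P_p(0 ↔ ∂B(n)) > 1/2`, the two-point mass satisfies
`Σ_{x ∈ B(n)} τ_p(0, x) ≥ c · n^a`. Kesten-1987-type stability below the finite-size length plus
`η < 1/3` at `p_c` (truth `2 − η ≈ 2.05`); rigorous floor `Σ_{B(n)} τ_{p_c} ≥ c n`. Size: open (L+). -/
theorem stub_quasicriticalMass :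
    ∃ a c : ℝ, 5 / 3 < a ∧ 0 < c ∧ ∀ p : unitInterval,
    (p : ℝ) < Literature.Probability.Percolation.criticalProb (Literature.Probability.LatticeModels.zdGraph 3) 0 →
      ∀ n : ℕ, 1 ≤ n →
        1 / 2 < ((2 * n + 1) ^ 3 : ℝ) *
            (Literature.Probability.Percolation.bondPercolation (Literature.Probability.LatticeModels.zdGraph 3) p).real
              (Literature.Probability.Percolation.siteToBoundary 3 n) →
          c * (n : ℝ) ^ a ≤ ∑ x ∈ Literature.Probability.LatticeModels.box 3 n, Literature.Probability.Percolation.tau 3 p 0 x := by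
  sorry

/-! ### Consistency: each named statement IS its registered stub (definitionally) -/

theorem chiUpperGammaTwo_holds : ChiUpperGammaTwo := stub_chiUpperGammaTwo
theorem quasicriticalMass_holds : QuasicriticalMass := stub_quasicriticalMass

/-! ### Name-keyed aliases of the two statements — the hypotheses of `Z3SubcritLengthExponent_of`

The native skeleton audit (`#h21_check_skeleton`) admits a hypothesis of the skeleton theorem only if
its head constant is a registered obligation or is NAMED like a declared stub; `Registered.stub_X` is
the statement of `stub_X` under that name, `rfl`-equal to it. -/
namespace Registered

/-- Alias of `ChiUpperGammaTwo` keyed by the registered stub name. -/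
abbrev stub_chiUpperGammaTwo : Prop := ChiUpperGammaTwo
/-- Alias of `QuasicriticalMass` keyed by the registered stub name. -/
abbrev stub_quasicriticalMass : Prop := QuasicriticalMass

end Registered

/-! ### The skeleton theorem: the two stubs imply the crux, BY NAME -/

/-- **`Z3SubcritLengthExponent` from the line `birth`** (kernel-checked, no `sorry` of its own).
With `a > 5/3`, `c > 0` from S2 and `C₁` from S1 put `ν := 2/a < 6/5`, `K := (max C₁ 1 / c)^{1/a}`
and `C := K + 1`. Let `p < p_c`, `ε := p_c − p > 0`, and `L ≥ C ε^{−ν}` (so `L ≥ 1`). If the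
criterion failed at `L`, S2 and `M_p(L) ≤ χ(p)` (summability below `p_c`) and S1 give
`c L^a ε² ≤ χ(p) ε² ≤ max C₁ 1`; but `L > K ε^{−2/a}` gives `L^a > K^a ε^{−2} = (max C₁ 1 / c) ε^{−2}`,
i.e. `c L^a ε² > max C₁ 1` — contradiction. -/
theorem Z3SubcritLengthExponent_of (h₁ : Registered.stub_chiUpperGammaTwo)
    (h₂ : Registered.stub_quasicriticalMass) :
    Summit.CriticalPhenomena.PercolationContinuityZ3.Theses.PercLoopDislocationCovers.Z3SubcritLengthExponent := by
  obtain ⟨C₁, hC₁⟩ := h₁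
  obtain ⟨a, c, ha, hc, hmass⟩ := h₂
  have ha0 : 0 < a := by linarith
  set C' : ℝ := max C₁ 1 with hC'_def
  have hC'1 : 1 ≤ C' := le_max_right _ _
  have hC'0 : 0 < C' := by linarith
  set K : ℝ := (C' / c) ^ (1 / a) with hK_def
  have hK0 : 0 ≤ K := Real.rpow_nonneg (div_pos hC'0 hc).le _
  refine ⟨2 / a, K + 1, ?_, ?_⟩
  · rw [div_lt_iff₀ ha0]
    linarith
  · intro p hp L hL
    by_contra hfail
    rw [not_le] at hfail
    set pc : ℝ := Literature.Probability.Percolation.criticalProb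
      (Literature.Probability.LatticeModels.zdGraph 3) 0 with hpc_def
    have hε : 0 < pc - (p : ℝ) := sub_pos.2 hp
    have hεν : 0 < (pc - (p : ℝ)) ^ (-(2 / a)) := Real.rpow_pos_of_pos hε _
    -- `L ≥ 1`
    have hLpos : (0 : ℝ) < L := lt_of_lt_of_le (mul_pos (by linarith) hεν) hL
    have hL1 : 1 ≤ L := by
      rcases Nat.eq_zero_or_pos L with h0 | h0
      · subst h0; simp at hLpos
      · exact h0
    -- S2 at (p, L) and `M_p(L) ≤ χ(p)` and S1
    have hm := hmass p hp L hL1 hfail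
    have hsum : ∑ x ∈ Literature.Probability.LatticeModels.box 3 L, Literature.Probability.Percolation.tau 3 p 0 x ≤
        Literature.Probability.Percolation.chi 3 p := by
      rw [Literature.Probability.Percolation.chi_def]
      exact (Literature.Probability.Percolation.summable_tau_of_lt_criticalProb (d := 3) (by norm_num) p hp).sum_le_tsum _
        (fun x _ => Literature.Probability.Percolation.tau_nonneg p 0 x)
    have hchi : Literature.Probability.Percolation.chi 3 p * (pc - p) ^ 2 ≤ C' := (hC₁ p hp).trans (le_max_left _ _)
    have hε2 : 0 < (pc - (p : ℝ)) ^ 2 := pow_pos hε 2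
    have h1 : c * (L : ℝ) ^ a * (pc - p) ^ 2 ≤ C' :=
      (mul_le_mul_of_nonneg_right (hm.trans hsum) hε2.le).trans hchi
    -- from `hL`: `K ε^{-2/a} < L`, hence `K^a ε^{-2} < L^a`
    have h2 : K * (pc - (p : ℝ)) ^ (-(2 / a)) < L := by
      have : K * (pc - (p : ℝ)) ^ (-(2 / a)) < (K + 1) * (pc - (p : ℝ)) ^ (-(2 / a)) :=
        mul_lt_mul_of_pos_right (by linarith) hεν
      exact this.trans_le hL
    have h3 : (K * (pc - (p : ℝ)) ^ (-(2 / a))) ^ a < (L : ℝ) ^ a :=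
      Real.rpow_lt_rpow (mul_nonneg hK0 hεν.le) h2 ha0
    have hKa : K ^ a = C' / c := by
      rw [hK_def, ← Real.rpow_mul (div_pos hC'0 hc).le, one_div_mul_cancel ha0.ne', Real.rpow_one]
    have hεa : ((pc - (p : ℝ)) ^ (-(2 / a))) ^ a = ((pc - (p : ℝ)) ^ 2)⁻¹ := by
      rw [← Real.rpow_mul hε.le, show (-(2 / a)) * a = -(2 : ℝ) by field_simp, Real.rpow_neg hε.le,
        Real.rpow_two]
    rw [Real.mul_rpow hK0 hεν.le, hKa, hεa] at h3
    -- multiply through by `c ε² > 0`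
    have h4 : C' < c * (L : ℝ) ^ a * (pc - p) ^ 2 := by
      have h5 := mul_lt_mul_of_pos_right h3 (mul_pos hc hε2)
      have hl : C' / c * ((pc - (p : ℝ)) ^ 2)⁻¹ * (c * (pc - (p : ℝ)) ^ 2) = C' := by
        field_simp
      have hr : (L : ℝ) ^ a * (c * (pc - (p : ℝ)) ^ 2) = c * (L : ℝ) ^ a * (pc - p) ^ 2 := by ring
      rw [hl, hr] at h5
      exact h5
    linarith

/-- Wiring check (an `example`, so that `Z3SubcritLengthExponent_of` stays the only theorem concluding
the crux): the registered stubs, with their tree-vocabulary types, feed the skeleton theorem as stated —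
this term becomes the crux proof when the two `sorry`s above are discharged. -/
example : Summit.CriticalPhenomena.PercolationContinuityZ3.Theses.PercLoopDislocationCovers.Z3SubcritLengthExponent :=
  Z3SubcritLengthExponent_of stub_chiUpperGammaTwo stub_quasicriticalMass

end Summit.CriticalPhenomena.PercolationContinuityZ3.Cruxes.Z3SubcritLengthExponent.Birth

end
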